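import Literature.Computability.MetaComplexity.SmolenskyProperty
import Mathlib.Algebra.Field.ZMod
import HarnessLib

/-!
# Cell qa-qnc0 (rung F-Q1, route RingFrame, crux α, line `product`): the dual-distance count behind
# the cap on "pure" level-set arguments (planner qa-qnc0-p1 TARGET §20.9(c))

TARGET §20.9(c) caps every PURE level-set certificate `R(b) = Σ_{a ∈ A'} R(a)` (an identity valid
for all column-degree-`D` maps) at sandwich ratio `≥ |A'| ≥ 2^{D+1} − 1`, because the support
`{b} ∪ A'` of such an identity is a dual Reed–Muller codeword, of weight `≥ 2^{D+1}`.  The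
combinatorial core, PROVED here without Reed–Muller duality:

* `two_pow_succ_le_card_of_sum_lowDeg_eq_zero`: a nonempty `T ⊆ {0,1}^L` with `Σ_{u ∈ T} g(u) = 0`
  for every `g` of `𝔽₂`-degree `≤ D` has `|T| ≥ 2^{D+1}` (induction on `D`: `g = 1` makes `|T|`
  even; split `T` along a separating coordinate `i` — both halves annihilate degree `D − 1`, since
  `g·x_i` and `g·(1 + x_i)` have degree `≤ D`);
* `two_pow_succ_le_card_succ_of_pure_identity`: if `g(b) = Σ_{a ∈ A'} g(a)` for all `g` of degree
  `≤ D` and `b ∉ A'`, then `2^{D+1} ≤ |A'| + 1`.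

(The bound is the minimum distance of `RM(D, L)^⊥ = RM(L − D − 1, L)`; tight: `T` = a
`(D+1)`-subcube.)  WHAT THIS IS NOT: nothing on `FSB` / `FW` / `LDRAgg`; the cap is on one
architecture of proofs, not on the crux; no separation claim.
-/

namespace Summit.QuantumAdvantage.AdviceFreeQNC0

open Finset
open Literature.Computability.MetaComplexity Literature.Computability.MetaComplexity.Smolensky

variable {L : ℕ}

/-- `1 ∈ lowDeg D`. -/
private theorem one_mem_lowDeg_dd (D : ℕ) : (1 : CubeFn (ZMod 2) L) ∈ lowDeg (ZMod 2) L D := by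
  rw [← mono_empty]; exact mono_mem_lowDeg (by simp)

/-- `x_i ∈ lowDeg 1`, pointwise form. -/
private theorem mono_singleton_apply (i : Fin L) (u : Fin L → Bool) :
    mono (ZMod 2) {i} u = if u i = true then 1 else 0 := by
  simp only [mono_apply, Finset.mem_singleton, forall_eq]

/-- **The dual-distance count.** A nonempty set of points of the cube on which every polynomial
of `𝔽₂`-degree `≤ D` sums to zero has at least `2^{D+1}` points. -/
theorem two_pow_succ_le_card_of_sum_lowDeg_eq_zero :
    ∀ (D : ℕ) (T : Finset (Fin L → Bool)), T.Nonempty →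
      (∀ g ∈ lowDeg (ZMod 2) L D, ∑ u ∈ T, g u = 0) → 2 ^ (D + 1) ≤ T.card := by
  classical
  intro D
  induction D with
  | zero =>
    intro T hT h
    have h1 := h 1 (one_mem_lowDeg_dd 0)
    simp only [Pi.one_apply, sum_const, nsmul_eq_mul, mul_one] at h1
    obtain ⟨m, hm⟩ := (ZMod.natCast_eq_zero_iff_even).1 h1
    have hpos : 0 < T.card := card_pos.2 hT
    omega
  | succ D ih =>
    intro T hT h
    -- `T` annihilates degree `D` as well, so it has at least two points
    have hD : ∀ g ∈ lowDeg (ZMod 2) L D, ∑ u ∈ T, g u = 0 :=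
      fun g hg => h g (lowDeg_mono (Nat.le_succ D) hg)
    have h2 : 1 < T.card := lt_of_lt_of_le (by
      have : 2 ≤ 2 ^ (D + 1) := by
        calc 2 = 2 ^ 1 := by norm_num
          _ ≤ 2 ^ (D + 1) := Nat.pow_le_pow_right (by norm_num) (by omega)
      omega) (ih T hT hD)
    obtain ⟨u, hu, u', hu', hne⟩ := one_lt_card.1 h2
    obtain ⟨i, hi⟩ := Function.ne_iff.1 hne
    -- split along coordinate `i`
    set T₁ := T.filter fun w : Fin L → Bool => w i = true with hT₁
    set T₀ := T.filter fun w : Fin L → Bool => ¬ w i = true with hT₀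
    have hcard : T₁.card + T₀.card = T.card := Finset.card_filter_add_card_filter_not _
    -- both halves are nonempty
    have hne₁ : T₁.Nonempty := by
      cases hui : u i with
      | true => exact ⟨u, mem_filter.2 ⟨hu, hui⟩⟩
      | false =>
        have : u' i = true := by
          cases hu'i : u' i with
          | true => rfl
          | false => exact absurd (hui.trans hu'i.symm) hi
        exact ⟨u', mem_filter.2 ⟨hu', this⟩⟩
    have hne₀ : T₀.Nonempty := by
      cases hui : u i with
      | false => exact ⟨u, mem_filter.2 ⟨hu, by rw [hui]; decide⟩⟩
      | true =>
        have : u' i = false := by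
          cases hu'i : u' i with
          | false => rfl
          | true => exact absurd (hui.trans hu'i.symm) hi
        exact ⟨u', mem_filter.2 ⟨hu', by rw [this]; decide⟩⟩
    -- both halves annihilate degree `D`
    have hann₁ : ∀ g ∈ lowDeg (ZMod 2) L D, ∑ w ∈ T₁, g w = 0 := by
      intro g hg
      have hmem : g * mono (ZMod 2) {i} ∈ lowDeg (ZMod 2) L (D + 1) :=
        mul_mem_lowDeg_add hg (mono_mem_lowDeg (by simp))
      have hs := h _ hmem
      rw [hT₁, sum_filter]
      have hsum : ∑ w ∈ T, (if w i = true then g w else 0) =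
          ∑ w ∈ T, (g * mono (ZMod 2) {i}) w :=
        sum_congr rfl fun w _ => by
          rw [Pi.mul_apply, mono_singleton_apply]
          by_cases hw : w i = true
          · rw [if_pos hw, if_pos hw, mul_one]
          · rw [if_neg hw, if_neg hw, mul_zero]
      rw [hsum]
      exact hs
    have hann₀ : ∀ g ∈ lowDeg (ZMod 2) L D, ∑ w ∈ T₀, g w = 0 := by
      intro g hg
      have hmem : g * (1 + mono (ZMod 2) {i}) ∈ lowDeg (ZMod 2) L (D + 1) :=
        mul_mem_lowDeg_add hg (Submodule.add_mem _ (one_mem_lowDeg_dd 1) (mono_mem_lowDeg (by simp)))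
      have hs := h _ hmem
      rw [hT₀, sum_filter]
      have h11 : (1 : ZMod 2) + 1 = 0 := by decide
      have hsum : ∑ w ∈ T, (if ¬ w i = true then g w else 0) =
          ∑ w ∈ T, (g * (1 + mono (ZMod 2) {i})) w :=
        sum_congr rfl fun w _ => by
          rw [Pi.mul_apply, Pi.add_apply, Pi.one_apply, mono_singleton_apply]
          by_cases hw : w i = true
          · rw [if_neg (not_not.2 hw), if_pos hw, h11, mul_zero]
          · rw [if_pos hw, if_neg hw, add_zero, mul_one]
      rw [hsum]
      exact hs
    have h₁ := ih T₁ hne₁ hann₁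
    have h₀ := ih T₀ hne₀ hann₀
    calc 2 ^ (D + 1 + 1) = 2 ^ (D + 1) + 2 ^ (D + 1) := by ring
      _ ≤ T₁.card + T₀.card := Nat.add_le_add h₁ h₀
      _ = T.card := hcard

/-- **The cap on pure identities** (TARGET §20.9(c)): if `g(b) = Σ_{a ∈ A'} g(a)` for every `g` of
`𝔽₂`-degree `≤ D`, with `b ∉ A'`, then `|A'| ≥ 2^{D+1} − 1`. -/
theorem two_pow_succ_le_card_succ_of_pure_identity {D : ℕ} (b : Fin L → Bool)
    (A' : Finset (Fin L → Bool)) (hb : b ∉ A')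
    (h : ∀ g ∈ lowDeg (ZMod 2) L D, g b = ∑ a ∈ A', g a) : 2 ^ (D + 1) ≤ A'.card + 1 := by
  classical
  have hT := two_pow_succ_le_card_of_sum_lowDeg_eq_zero D (insert b A') (insert_nonempty b A')
    (fun g hg => by
      rw [sum_insert hb, ← h g hg]
      have : ∀ x : ZMod 2, x + x = 0 := by decide
      exact this (g b))
  rw [card_insert_of_notMem hb] at hT
  exact hT

end Summit.QuantumAdvantage.AdviceFreeQNC0
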